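import Summits.QuantumFields.YangMills.Theses.ForcedResponseSkewness
import Summits.QuantumFields.YangMills.Theorems.ForcedResponseSkewnessResponseLocalisationDefs
import Summits.QuantumFields.YangMills.Theorems.ForcedResponseSkewnessResponseLocalisationStubCollarOfKernel

/-!
# Skeleton «collar-kernel» for the RESTATED deciding crux `ResponseLocalisation` (stmt-QuantumFields-24869; route
# `ForcedResponseSkewness` rev 5 «RESTATE-FAR»; lead `ym-line-frs-p1` g2, 2026-08-28)

After rev 4/5 the crux IS the contact half of response localisation: for a base point with `p₀ > 0`, floor level `ε`, tolerance
`η` and window `[1,Λ]`, SOME support radius `ρ > 0` such that every positive-time source `v ⊆ closedBall p ρ`, `∫|v| ≤ 1`,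
carrying the floor admits `δ > 0` with: the δ-COLLAR mass of the response profile `respM` (third action-density insertion within
physical `δ` of `supp v ∪ supp θv`, including the supports themselves) is `≤ η·(1 + |∂_cQ2|)` for all large `β`, tori
`aβ·L ≥ Λ₆`, `l ∈ [1,Λ]`.  (The far-field half is now a clause of the residual `FloorWithScalingLimits` 24873; split/plateau glue
landed; the Assembly is re-landed against rev 5, p598681.)

The line cuts the crux into ONE kernel-level physics statement and a smearing reduction:

ResponseLocalisation ⇐ stub_contactKernel   (PHYSICS, XL, hardest: `ContactKernelSigR` — for a PINNED unit, pairs at physical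
                                             separation in `[r₁,r₂]`, every `κ > 0`: a physical radius `R` with
                                             `Σ_{x : aβ·d_T(x,z) < R} |torusK3 x y z| ≤ κ·(aβ)⁸` on all large tori — the integrated
                                             contact coefficient vanishes with the cut; RG-improved one loop: `≈ ḡ²(R)/2·C₂(r)a⁸/r⁸`
                                             (lead's INSTRUMENT note + `…ContactOneLoop` p598136: FAVOURABLE); as a theorem = OPE
                                             factorisation `κ₃ ≈ C^A·Cov` with error control along the unit — not in print)
                     + stub_collarOfKernel   (ANALYSIS, L, provable now: `CollarOfKernelSigR := ContactKernelSigR → crux body` —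
                                             Riemann sums, support geometry of the ball and its reflection, collar ⊆ two R-balls once
                                             `2ρ + δ < R`, symmetry of `torusK3`, pinning witness by a classical case split; `κ = η/16`)
Statements in `Theorems/ForcedResponseSkewnessResponseLocalisationDefs.lean` (rev-5 append p598950).  `stub_collarOfKernel` LANDED (frs-p2,
p600411); composition below = one line (the analysis stub concludes the crux body verbatim); ONE sorry left = `stub_contactKernel`.  No summit is proved by any of this (leaf R2a `BalabanLadder.NT`,
conditional on the residual 24873 ∋ NT clause (i) + the far/IR clause; the YM mass gap is NOT proved).
-/

set_option autoImplicit false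

noncomputable section

namespace Summit.QuantumFields.YangMills.Cruxes.ResponseLocalisation.Collar

open MeasureTheory Filter Topology
open Literature.MathematicalPhysics.QuantumFieldTheory Literature.MathematicalPhysics.QuantumLattice
open Literature.Probability.LatticeModels
open Summit.QuantumFields.YangMills.Cruxes.OSLegsFromFemtoAndGap.DlrCollarTransfer
open Summit.QuantumFields.YangMills.Cruxes.ResponseLocalisation.Birth
open Summit.QuantumFields.YangMills.Theses.ForcedResponseSkewness

/-! ## The registered stubs -/

theorem stub_contactKernel : ContactKernelSigR := by
  sorry

-- stub_collarOfKernel : CollarOfKernelSigR — LANDED by the width seat frs-p2 (p600411,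
-- Theorems/ForcedResponseSkewnessResponseLocalisationStubCollarOfKernel.lean, this namespace), imported above.

/-- COMPOSITION (kernel-checked): the analysis stub applied to the physics stub IS the crux (its body verbatim). -/
theorem ResponseLocalisation_holds : ResponseLocalisation :=
  stub_collarOfKernel stub_contactKernel

end Summit.QuantumFields.YangMills.Cruxes.ResponseLocalisation.Collar

end
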